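import Literature.Computability.ImplicitComplexity.SoftTypeAssignmentSubstFamily
import HarnessLib

/-!
# The substitution lemma of `STA₊`, III: moving the substituends to fresh slots

Continuation of `SoftTypeAssignmentSubstFamily.lean` (GR07/GMR08 Substitution Lemma). The case
of the multiplexor `(m)` needs the contexts of the substituends to avoid the slots contracted by
the multiplexor, and needs renamed-apart COPIES of a substituend. Both are instances of
transporting a family along an injective renaming of slots; this file provides

* `STA.swapBlock T K` — the involution of `ℕ` exchanging a finite block `T` (below `K`) with its
  translate `T + K`, fixing everything else;
* `Family.conj` — conjugating a family by an involution `π` that moves the substituends' slots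
  off the main context: the substituends are renamed by `π`, their context transported;
* `SubstGoal.conj_back` — a solution of the substitution goal for the conjugated family yields
  one for the original family (rename the result derivation back by `π`, which fixes the main
  context and undoes itself on the substituends).

Folklore bookkeeping; no new mathematics.

## References

* [GaboardiRonchiDellaRocca2007] GR07, Substitution Lemma (variable convention).
-/

namespace Literature.Computability.ImplicitComplexity

namespace STA

open Finset

/-! ### Block swaps -/

/-- The involution exchanging the block `T` with `T + K` (meaningful when `T < K`). [folklore] -/
def swapBlock (T : Finset ℕ) (K : ℕ) (i : ℕ) : ℕ :=
  if i ∈ T then i + K else if K ≤ i ∧ i - K ∈ T then i - K else i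

/-- On the block, the swap translates by `K`. [folklore] -/
theorem swapBlock_of_mem {T : Finset ℕ} (K : ℕ) {i : ℕ} (h : i ∈ T) : swapBlock T K i = i + K := by
  simp [swapBlock, h]

/-- Below `K` and off the block, the swap fixes. [folklore] -/
theorem swapBlock_of_lt {T : Finset ℕ} {K i : ℕ} (h : i ∉ T) (hi : i < K) : swapBlock T K i = i := by
  have : ¬(K ≤ i ∧ i - K ∈ T) := fun h' => absurd h'.1 (not_le.2 hi)
  simp [swapBlock, h, this]

/-- The swap is an involution when the block lies below `K`. [folklore] -/
theorem swapBlock_involutive {T : Finset ℕ} {K : ℕ} (hT : ∀ t ∈ T, t < K) :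
    Function.Involutive (swapBlock T K) := by
  intro i
  by_cases h1 : i ∈ T
  · have hnot : i + K ∉ T := fun h => by have := hT _ h; omega
    rw [swapBlock_of_mem K h1]
    simp [swapBlock, hnot, h1]
  · by_cases h2 : K ≤ i ∧ i - K ∈ T
    · have e1 : swapBlock T K i = i - K := by simp [swapBlock, h1, h2]
      rw [e1, swapBlock_of_mem K h2.2]
      omega
    · have e1 : swapBlock T K i = i := by simp [swapBlock, h1, h2]
      rw [e1, e1]

/-- The swap moves the block above `K`. [folklore] -/
theorem le_swapBlock_of_mem {T : Finset ℕ} (K : ℕ) {i : ℕ} (h : i ∈ T) : K ≤ swapBlock T K i := by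
  rw [swapBlock_of_mem K h]
  omega

/-- Members of a finite set lie below its successor-of-sup. [folklore] -/
theorem lt_sup_id_succ {U : Finset ℕ} {i : ℕ} (h : i ∈ U) : i < U.sup id + 1 :=
  Nat.lt_succ_of_le (le_sup (f := id) h)

/-! ### Transport of contexts along an involution -/

/-- The transported context along an involution, pointwise. [folklore] -/
theorem Ctx.remap_involutive_apply {π : ℕ → ℕ} (hπ : Function.Involutive π) (Γ : Ctx) (j : ℕ) :
    Γ.remap π j = Γ (π j) := by
  conv_lhs => rw [← hπ j]
  exact Ctx.remap_apply hπ.injective Γ (π j)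

/-! ### Conjugating a family -/

namespace Family

variable {r : ℕ} {Θ : Ctx} {X : Finset ℕ} {N : ℕ → Term} {Δ : Ctx} {c ℓ wt e : ℕ → ℕ}

/-- **Conjugation of a family by an involution** moving the substituends' slots to slots that are
not declared in the main context. [folklore] -/
theorem conj (F : Family r Θ X N Δ c ℓ wt e) {π : ℕ → ℕ} (hπ : Function.Involutive π)
    (hout : ∀ i, Δ i ≠ none → Θ (π i) = none) :
    Family r Θ X (fun x => (N x).rename π) (Δ.remap π) (c ∘ π) ℓ wt e where
  deriv x hx := by
    obtain ⟨B, hB, hD⟩ := F.deriv x hx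
    refine ⟨B, hB, (hD.rename hπ.injective).of_eq_ctx (funext fun j => ?_)⟩
    rw [Ctx.remap_involutive_apply hπ, Ctx.part_apply, Ctx.part_apply,
      Ctx.remap_involutive_apply hπ]
    rfl
  tight x hx j hj := by
    have hj' : (Δ.part c x) (π j) ≠ none := by
      simpa [Ctx.remap_involutive_apply hπ] using hj
    have := F.tight x hx (π j) hj'
    exact Term.mem_fv_rename.2 ⟨π j, this, hπ j⟩
  disjoint j hj := by
    rw [Ctx.remap_involutive_apply hπ] at hj
    simpa [hπ j] using hout (π j) hj
  owned j hj := by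
    rw [Ctx.remap_involutive_apply hπ] at hj
    exact F.owned (π j) hj

/-- The result context of the conjugated family, transported back, is the result context.
[folklore] -/
theorem resCtx_conj (F : Family r Θ X N Δ c ℓ wt e) {π : ℕ → ℕ} (hπ : Function.Involutive π)
    (hfix : ∀ i, Θ i ≠ none → π i = i) :
    (resCtx Θ X (Δ.remap π) (c ∘ π) ℓ).remap π = resCtx Θ X Δ c ℓ := by
  funext j
  rw [Ctx.remap_involutive_apply hπ, resCtx_apply, resCtx_apply, Ctx.levelled_apply,
    Ctx.levelled_apply, Ctx.remap_involutive_apply hπ]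
  simp only [Function.comp_apply, hπ j]
  by_cases hΘ : Θ j ≠ none
  · -- declared slots are fixed by `π`
    rw [hfix j hΘ]
  · push Not at hΘ
    have hjX : j ∉ X := fun h => F.declared h hΘ
    have hπΘ : Θ (π j) = none := by
      by_contra hne
      have := hfix (π j) hne
      rw [hπ j] at this
      exact hne (this ▸ hΘ)
    have hπX : π j ∉ X := fun h => F.declared h hπΘ
    simp [hjX, hπX, hΘ, hπΘ]

/-- The substituted term of the conjugated family, renamed back, is the substituted term.
[folklore] -/
theorem famSubst_conj (X : Finset ℕ) (N : ℕ → Term) {π : ℕ → ℕ} (hπ : Function.Involutive π)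
    (hfix : ∀ i, Θ i ≠ none → π i = i) {w d : ℕ} {P : Term} {τ : SoftTy}
    (E : WTyping r w d Θ P τ) :
    (P.substp (famSubst X fun x => (N x).rename π)).rename π = P.substp (famSubst X N) := by
  rw [Term.rename_substp]
  refine Term.substp_congr_fv fun i hi => ?_
  by_cases hiX : i ∈ X
  · rw [famSubst_of_mem _ hiX, famSubst_of_mem _ hiX, Term.rename_rename]
    rw [show π ∘ π = id from funext hπ, Term.rename_id]
  · rw [famSubst_of_not_mem _ hiX, famSubst_of_not_mem _ hiX]
    show Term.var (π i) = Term.var i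
    rw [hfix i (E.ne_none_of_mem_fv hi)]

end Family

/-- **Transport of the substitution goal back along a conjugation**: a result derivation for the
conjugated family renames to a result derivation for the original one. [folklore] -/
theorem SubstGoal.conj_back {r w d : ℕ} {Θ : Ctx} {P : Term} {τ : SoftTy} (E : WTyping r w d Θ P τ)
    {X : Finset ℕ} {N : ℕ → Term} {Δ : Ctx} {c ℓ wt e : ℕ → ℕ} (F : Family r Θ X N Δ c ℓ wt e)
    {π : ℕ → ℕ} (hπ : Function.Involutive π) (hfix : ∀ i, Θ i ≠ none → π i = i) {w' d' : ℕ}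
    (h : WTyping r w' d' (resCtx Θ X (Δ.remap π) (c ∘ π) ℓ) (P.substp (famSubst X fun x => (N x).rename π)) τ) :
    WTyping r w' d' (resCtx Θ X Δ c ℓ) (P.substp (famSubst X N)) τ := by
  have := h.rename hπ.injective
  rwa [F.resCtx_conj hπ hfix, Family.famSubst_conj X N hπ hfix E] at this

/-! ### A fresh bound for a family and a finite set of taboo slots -/

namespace Family

variable {r : ℕ} {Θ : Ctx} {X : Finset ℕ} {N : ℕ → Term} {Δ : Ctx} {c ℓ wt e : ℕ → ℕ}

/-- The slots of the substituends' context form the union of their free variables. [folklore] -/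
theorem ne_none_iff (F : Family r Θ X N Δ c ℓ wt e) (i : ℕ) :
    Δ i ≠ none ↔ ∃ x ∈ X, i ∈ (N x).fv ∧ c i = x := by
  constructor
  · exact fun hi => ⟨c i, F.owned i hi, F.mem_fv hi, rfl⟩
  · rintro ⟨x, hx, hfv, hc⟩
    obtain ⟨B, _, hD⟩ := F.deriv x hx
    have := hD.ne_none_of_mem_fv hfv
    simpa [hc] using this

/-- **Moving a family off a finite set of slots.** Given finitely many taboo slots `U` (containing
the declared slots of `Θ`), there is an involution `π` fixing every slot below the bound and
moving every slot of the substituends above it. [folklore] -/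
theorem exists_swap (F : Family r Θ X N Δ c ℓ wt e) (U : Finset ℕ) (hU : ∀ i, Θ i ≠ none → i ∈ U) :
    ∃ (π : ℕ → ℕ) (K : ℕ), Function.Involutive π ∧ (∀ i ∈ U, i < K) ∧
      (∀ i, i < K → Δ i = none → π i = i) ∧ (∀ i, Θ i ≠ none → π i = i) ∧
      (∀ i, Δ i ≠ none → K ≤ π i ∧ π i < 2 * K) ∧ (∀ i, Δ i ≠ none → i < K) := by
  classical
  set T : Finset ℕ := X.biUnion fun x => (N x).fv with hT
  set K : ℕ := (U ∪ T).sup id + 1 with hK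
  have hTK : ∀ t ∈ T, t < K := fun t ht => lt_sup_id_succ (mem_union_right _ ht)
  have hUK : ∀ i ∈ U, i < K := fun i hi => lt_sup_id_succ (mem_union_left _ hi)
  have hΔT : ∀ i, Δ i ≠ none → i ∈ T := fun i hi => F.mem_biUnion_fv hi
  have hTΔ : ∀ i ∈ T, Θ i = none := by
    intro i hi
    obtain ⟨x, hx, hfv⟩ := mem_biUnion.1 hi
    obtain ⟨B, _, hD⟩ := F.deriv x hx
    have h1 : (Δ.part c x) i ≠ none := hD.ne_none_of_mem_fv hfv
    have h2 : Δ i ≠ none := by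
      simp only [Ctx.part_apply] at h1
      by_cases h : c i = x
      · simpa [h] using h1
      · simp [h] at h1
    exact F.disjoint i h2
  refine ⟨swapBlock T K, K, swapBlock_involutive hTK, hUK, ?_, ?_, ?_, ?_⟩
  · intro i hi hΔ
    by_cases hiT : i ∈ T
    · -- a free variable of a substituend that is not a slot of `Δ`: impossible
      obtain ⟨x, hx, hfv⟩ := mem_biUnion.1 hiT
      obtain ⟨B, _, hD⟩ := F.deriv x hx
      have h1 : (Δ.part c x) i ≠ none := hD.ne_none_of_mem_fv hfv
      simp only [Ctx.part_apply] at h1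
      by_cases h : c i = x
      · simp [h, hΔ] at h1
      · simp [h] at h1
    · exact swapBlock_of_lt hiT hi
  · intro i hi
    have hiT : i ∉ T := fun h => hi (hTΔ i h)
    exact swapBlock_of_lt hiT (hUK i (hU i hi))
  · intro i hi
    have hiT := hΔT i hi
    rw [swapBlock_of_mem K hiT]
    have := hTK i hiT
    omega
  · exact fun i hi => hTK i (hΔT i hi)

end Family

end STA

end Literature.Computability.ImplicitComplexity
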